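import Literature.MathematicalPhysics.QuantumFieldTheory.Balaban1983to89.Node00.CarriersB13DecoratedTower
import Literature.MathematicalPhysics.QuantumFieldTheory.Balaban1983to89.B13CondTowerLocationNumerals
import Literature.MathematicalPhysics.QuantumFieldTheory.Balaban1983to89.B13CondTowerAccretiveFloorMax
import Literature.MathematicalPhysics.QuantumFieldTheory.Balaban1983to89.B13CountBinderObstruction
import Literature.MathematicalPhysics.QuantumFieldTheory.Balaban1983to89.B13TermSizeLaws
import Literature.MathematicalPhysics.QuantumFieldTheory.Balaban1983to89.B13CubeSumTorus
import Literature.MathematicalPhysics.QuantumFieldTheory.Balaban1983to89.B13ChainJointNonvacuityPrefactors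

/-!
# `Balaban1983to89.Node00.CarriersB13BondTower` — T. Bałaban, *Renormalization group approach to lattice gauge field theories. II. Cluster
expansions*, Commun. Math. Phys. **116** (1988) 1–22, doi:10.1007/bf01239022 [Balaban1988RG2Cluster]:
**THE BOND-INDEXED OBJECT TOWER — ONE decorated residual layer `bondTower θ n k m₃ c g R : ResidB13D θ` meeting EVERY OBJECT ∕ SIZE binder of the N10
junction of record 67V ∕ 67VL AT ONCE (storey S7 of the carriers; A6 model, nothing of Bałaban's operators constructed)**

statement-level skeleton of published theorems with citation tags; proofs where landed; nothing here is a claim about the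
Yang–Mills mass gap

CITATION HEADER (verbatim).  p. 12 [PDF 12], (2.3): *"Here the symbol |P| means the number of bonds in the set P"* and (2.5): the conditioning `C*Δ_k(σ)C`
on the bonds of `Z₀`; p. 13: *"σ-cubes sufficiently far from the bonds of the term"*-type geometry (the cell's `hKfar`); p. 14, (2.9); p. 15, (2.14) and
*"for (U, 0) the operators are symmetric, and the measure is positive"*; p. 20 [PDF 20], before (2.37): «O(1)(LM)⁴α₅».  NOT PRINTED: every object below —
a finite-matrix ∕ finite-torus MODEL inhabiting the typed hypothesis SHAPES of the junction (director-ym №189 A6 rule), as the earlier storeys' `hopCond`,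
`blockDecorated`, `unitDecorated`.

WHY THIS FILE (cell `pub-ymgap`, node N10 = [B13], seat `pub-ymgap-dag-n10-w3` g4; own-stem successor of this seat's S5 ∕ S6 carriers and witnesses
(`CarriersB13CondTower(Witness)`, `CarriersB13DecoratedTower(Witness)`), of `B13CountBinderObstruction` (p612518), the junction of record 67V (p614443),
`B13VolumeDialNumerals` (p615756) and `B13TermSizeLaws`).  Lane census v18 item 3: *the JOINT inhabitant of 67V at the existing constants families* splits
into (a) an OBJECT tower meeting every object ∕ size binder at once, (b) the numerics witness re-dialled for the dial-weighted volume binder, (c) the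
application.  THIS FILE is (a): the decorated layer whose row-bond index of the term `t = (𝐃, P)` IS the term's bond family (`Λ Z t := ↥t.2`, `Pl := univ`,
so the junction's `hPcard` holds by counting and the size letter is `V = 4((m₃+1)(ℓ₆+1))⁴` by `B13TermSizeLaws`), with NO exterior bond (`C₀ := PEmpty`), fine
bonds `P := Λ ⊕ C₀` averaged by `C := 1`, the CONSTANT σ-free fluctuation operator `Δ₀ := 4·1` (no decoration, `J := ∅`) — so the conditioned operator is
`4·1` at every `(σ, u)` and its real reference value `K₀ = 4·1 ≻ 0` has Rayleigh floor `4 ≥ m₀` for the reference packages of record (`m₀ = 2`) —, the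
one-dimensional site torus `ℤ∕N⋆` of [13] with `N⋆ = 2(B + R + 1)` (`B` = the number of bonds of the fine torus) on which the term's bonds sit INJECTIVELY at
`R+1, …, R+B` and the σ-region is the single site `0` — so every bond is at `d₁`-distance `≥ R + 1` from the σ-region (the junction's `hRσfloor` for every
`R_σ ≤ R + 1`) and every location fibre has ONE element (`hnB` at `n_B = 1`, `hm ∕ hmF` at `1`) —, the Lemma-1∕2 index families EMPTY and the block distance
`dist := M·(side of the j-torus)` (so `hdist` holds by the covering lemma `B13CubeSumTorus.image_pbox_eq_univ`), all potentials ZERO, spaces `univ`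
(non-empty — ref-B's A1), `GaugeInv := True`.

WHAT THIS FILE PROVES (0 `sorry`).  §1 the data (`bondN`, `bondPt`, `bondBase`, `bondCond`, `bondTower` and their index ∕ location functions) and the ONE
kernel computation `decoratedOp_diagonal_noDecor_one` (`1ᵀ·sDecorate_∅(½·raw(D) ⊕ ½·raw(D)ᵀ)·1 = D` for a real diagonal `D`, at every `(σ,u)`); §2 `rfl`
faces; §3 the geometry of `ℤ∕N⋆` (`tdist1_bondPt_zero_ge`: `d₁(R+1+p, 0) ≥ R+1` for `p < B`); §4 ★ THE OBJECT ∕ SIZE BINDERS OF 67V ∕ 67VL AT THE TOWER, by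
name of the binder: `bondTower_hPcard`, `bondTower_hKX`, `bondTower_hEL` (for every `B_Δ ≥ 4`, every rate, every radius), `bondTower_locNFibreMax_le_one`
(⟹ `hm`, `hnB` at `1`), `bondTower_locFFibreMax_le_one` (`hmF`), `bondTower_le_sigmaDistFloor` (`hRσfloor` for `R_σ ≤ R+1`), `bondTower_le_accretiveFloorMax`
(`hm₀` for `m₀ ≤ 4`), `bondTower_hsymm ∕ _hthrough ∕ _decorExcess_le` (`hGJ`'s laws, `hc₀` at any `c₀`), `bondTower_cmAbsMax_le_one`, `bondTower_cmRange_le`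
(any `r_C ≥ 0`), `bondTower_card_Λ_le ∕ _card_sum_le ∕ _card_biUnion_le` (the three size laws with `V = 4((m₃+1)(ℓ₆+1))⁴`), `bondTower_hdist` (for `0 ≤ δ₀`,
`0 ≤ M`), `bondTower_hι ∕ _hfibc ∕ _hBv ∕ _hBv0 ∕ _hχsupp ∕ _hQsupp ∕ _huα ∕ _hsp ∕ _rd_eq_zero ∕ _V_eq_zero ∕ _hVm ∕ _hsmallm ∕ _hG ∕ _he ∕ _hcard`, and the
EMPTY-family facts `bondTower_S0 ∕ _Sc ∕ _s ∕ _F ∕ _SX ∕ _SX'` (`rfl`) that make `hS0Y hSq hX0 hAnT hAnT' h124 h130 hW hKW hAnP` vacuous.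

HONEST SCOPE.  A MODEL: finite matrices and a one-dimensional site torus chosen so that the typed object binders hold jointly; `Δ₀ = 4·1` is NOT Bałaban's
`Δ_k(σ,𝐔,𝐉)`, the site torus is NOT NODE 00's reading, the empty Lemma-1∕2 families are NOT print's (1.33) families — exactly as in every A6 witness of this
chain.  What it certifies, once (b)+(c) land: the 135 binders of the junction of record are JOINTLY satisfiable at the tree's constants families (which the
θ-free editions were not, p612518).  Nothing of Bałaban's asserted; N10 NOT discharged; K1⁷ NOT claimed; count-neutral; one finite four-torus programme at
fixed ε; nothing continuum ∕ ℝ⁴ ∕ OS ∕ mass-gap ∕ Clay.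
-/

noncomputable section

namespace Literature.MathematicalPhysics.QuantumFieldTheory.Balaban1983to89.Node00

open T4Continuum AveragingRT T4FiniteEpsInhabited FlowStep FlowStepRuns DagBinding T4DatumAssembly
open MeasureTheory Metric
open scoped Matrix
open Literature.MathematicalPhysics.QuantumFieldTheory.Balaban1983to89.TreeLengthTorus (TDom TPt IsTDom natLift proj tsys)
open Literature.MathematicalPhysics.QuantumFieldTheory.Balaban1983to89.TreeLengthTorusTransfer (tcoarse)
open Literature.MathematicalPhysics.QuantumFieldTheory.Balaban1983to89.B13Lemma3TorusData (TBond)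
open Literature.MathematicalPhysics.QuantumFieldTheory.Balaban1983to89.B13Lemma3TorusTerms (terms Z0)
open Literature.MathematicalPhysics.QuantumFieldTheory.Balaban1983to89.B5TorusCover (UT)
open Literature.MathematicalPhysics.QuantumFieldTheory.Balaban1983to89.B9Thm37GlueTorus (tdist1 tdist1_self tdist1_nonneg)
open Literature.MathematicalPhysics.QuantumFieldTheory.Balaban1983to89.B13Eq111SDecoupling (sDecorate sTerm sTerm_of_empty sTerm_apply sDecorate_apply)
open Literature.MathematicalPhysics.QuantumFieldTheory.Balaban1983to89.B13EntrywiseWalks (RawEntryLetters rawEntryTerm)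
open Literature.MathematicalPhysics.QuantumFieldTheory.Balaban1983to89.B16Absorption (pbox)
open Literature.MathematicalPhysics.QuantumFieldTheory.Balaban1983to89.B13CubeSumTorus (image_pbox_eq_univ)
open Literature.MathematicalPhysics.QuantumFieldTheory.Balaban1983to89.B13BlockGeometryTorus (card_fiber_tcoarse_le)
open Literature.MathematicalPhysics.QuantumFieldTheory.Balaban1983to89.B13CondTowerLocationNumerals
  (locNFibreMax sigmaDistFloor locFFibreMax decorExcess cmAbsMax cmRange locNFibreMax_le_of_forall locFFibreMax_le_of_forall le_sigmaDistFloor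
    decorExcess_le_of_card_le cmAbsMax_le_of_forall cmRange_le_of_forall)
open Literature.MathematicalPhysics.QuantumFieldTheory.Balaban1983to89.B13CondTowerAccretiveFloorMax (accretiveFloorMax le_accretiveFloorMax_decTower_of_rayleighFloor)
open Literature.MathematicalPhysics.QuantumFieldTheory.Balaban1983to89.B13CountBinderObstruction (isTDom_univ univ_mem_terms)
open Literature.MathematicalPhysics.QuantumFieldTheory.Balaban1983to89.B13TermSizeLaws (card_bonds_le_real card_biUnion_doms_le_real)

/-! ## §1. The data -/

section BondTower

/-- **THE ONE KERNEL COMPUTATION OF THIS STOREY**: for a CONSTANT real-diagonal fluctuation operator `u ↦ D` on the fine bonds, NO decoration and the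
identity averaging operator, the decorated operator is `1ᵀ·(½·Σ_ω raw_ω(D) + ½·Σ_ω raw_ω(D)ᵀ)·1 = D` at EVERY `(σ, u)` (the raw entry terms of [13] (3.107)
re-assemble the matrix; a diagonal matrix is its own transpose). [cite: Balaban1988RG2Cluster, (2.5)–(2.8) pp.12–14 (degenerate data); Balaban1985BackgroundPropagators, (3.107) p.416] -/
theorem decoratedOp_diagonal_noDecor_one {n₁ : ℕ} {E₃ : Type} [NormedAddCommGroup E₃] [NormedSpace ℂ E₃] {B : Type} [Fintype B] [DecidableEq B]
    (dC : B → ℂ) (σ : TPt 4 n₁ → ℂ) (u : E₃) :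
    decoratedOp (n₁ := n₁) (fun _ : E₃ => Matrix.diagonal dC) (fun _ => ∅) (1 : Matrix B B ℝ) σ u = Matrix.diagonal dC := by
  classical
  simp only [decoratedOp]
  rw [Matrix.map_one (algebraMap ℝ ℂ) (map_zero _) (map_one _), Matrix.transpose_one, Matrix.one_mul, Matrix.mul_one]
  ext i j
  rw [sDecorate_apply, tsum_fintype]
  simp only [sTerm_apply, Finset.prod_empty, one_mul, Fintype.sum_sum_type, Sum.elim_inl, Sum.elim_inr, Matrix.smul_apply,
    Matrix.transpose_apply, smul_eq_mul, rawEntryTerm, Matrix.diagonal_apply]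
  rw [Fintype.sum_prod_type, Fintype.sum_prod_type]
  simp only [mul_ite, mul_zero]
  -- both double sums collapse to the single entry `(i, j)` resp. `(j, i)`
  have h1 : ∑ a : B, ∑ b : B, (if i = a ∧ j = b then (if a = b then (1 / 2 : ℂ) * dC a else 0) else 0)
      = if i = j then (1 / 2 : ℂ) * dC i else 0 := by
    rw [Finset.sum_eq_single i, Finset.sum_eq_single j]
    · simp
    · intro b _ hb; simp [Ne.symm hb]
    · intro h; exact absurd (Finset.mem_univ _) h
    · intro a _ ha; exact Finset.sum_eq_zero fun b _ => by simp [Ne.symm ha]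
    · intro h; exact absurd (Finset.mem_univ _) h
  have h2 : ∑ a : B, ∑ b : B, (if j = a ∧ i = b then (if a = b then (1 / 2 : ℂ) * dC a else 0) else 0)
      = if i = j then (1 / 2 : ℂ) * dC i else 0 := by
    rw [Finset.sum_eq_single j, Finset.sum_eq_single i]
    · by_cases hij : i = j
      · subst hij; simp
      · simp [hij, Ne.symm hij]
    · intro b _ hb; simp [Ne.symm hb]
    · intro h; exact absurd (Finset.mem_univ _) h
    · intro a _ ha; exact Finset.sum_eq_zero fun b _ => by simp [Ne.symm ha]
    · intro h; exact absurd (Finset.mem_univ _) h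
  rw [h1, h2]
  split_ifs <;> ring

/-- The real reference value `4·1` read as a complex diagonal. [cite: Balaban1988RG2Cluster, p.15 (bookkeeping)] -/
theorem diagonal_four_map {B : Type} [DecidableEq B] : ((Matrix.diagonal fun _ : B => (4 : ℝ)).map (algebraMap ℝ ℂ) : Matrix B B ℂ) = Matrix.diagonal fun _ => (4 : ℂ) := by
  ext i j
  simp only [Matrix.map_apply, Matrix.diagonal_apply]
  split_ifs <;> simp

variable (θ : Stage3Params)

/-- The number of bonds of the fine torus of the terms (`(m₃+1)·(ℓ₆+1)(n+1)` sites per direction, 4 directions). [cite: Balaban1988RG2Cluster, (2.3) p.12] -/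
def bondCount (n m₃ : ℕ) : ℕ := Fintype.card (TBond 4 (m₃ + 1) ((θ.ℓ₆ + 1) * (n + 1)))

/-- The period of [13]'s one-dimensional site torus of the model: `N⋆ = 2(B + R) + 2`. [cite: Balaban1985BackgroundPropagators, Thm 3.10 p.416 (the site torus; model)] -/
abbrev bondN (n m₃ R : ℕ) : Fin 1 → ℕ := fun _ => 2 * (bondCount θ n m₃ + R) + 1 + 1

/-- The site `p mod N⋆` of the one-dimensional site torus. [cite: Balaban1985BackgroundPropagators, Thm 3.10 p.416 (model)] -/
def bondPt (n m₃ R : ℕ) (p : ℕ) (hp : p < 2 * (bondCount θ n m₃ + R) + 1 + 1) : UT (bondN θ n m₃ R) := fun _ => ⟨p, hp⟩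

/-- The location of a bond of the fine torus: the `e(b)`-th site after `R`, `e` an enumeration of the bonds (`R + 1 + e(b) < N⋆`).
[cite: Balaban1985BackgroundPropagators, Thm 3.10 p.416 (model)] -/
def bondLoc (n m₃ R : ℕ) (b : TBond 4 (m₃ + 1) ((θ.ℓ₆ + 1) * (n + 1))) : UT (bondN θ n m₃ R) :=
  bondPt θ n m₃ R (R + 1 + (Fintype.equivFin (TBond 4 (m₃ + 1) ((θ.ℓ₆ + 1) * (n + 1))) b).val) (by
    have := (Fintype.equivFin (TBond 4 (m₃ + 1) ((θ.ℓ₆ + 1) * (n + 1))) b).isLt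
    unfold bondCount; omega)

/-- The σ-site of every term: the origin of the site torus. [cite: Balaban1988RG2Cluster, p.13 (the σ-region; model)] -/
def bondX (n m₃ R : ℕ) : UT (bondN θ n m₃ R) := bondPt θ n m₃ R 0 (by omega)

/-- **The base (g0) layer of the model**: configurations = complex bond fields of the fine torus, bonds = the fine torus's bonds, spaces `univ`, every
(1.33) ∕ (1.40)–(1.42) family EMPTY, every potential ZERO, `GaugeInv := True`, the given constants `c`, coupling `g`, sizes `n, k, m₃`.
[cite: Balaban1988RG2Cluster, (1.33) p.9, (1.40)–(1.42) pp.10–11, (2.3) p.12 (degenerate data)] -/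
def bondBase (n k m₃ : ℕ) (c : B13.Consts) (g : ℂ) : ResidB13 θ where
  n := n
  k := k
  Φ := TBond 4 (m₃ + 1) ((θ.ℓ₆ + 1) * (n + 1)) → ℂ
  Bond := TBond 4 (m₃ + 1) ((θ.ℓ₆ + 1) * (n + 1))
  sp1 := fun _ => Set.univ
  sp2 := fun _ => Set.univ
  Bv := fun φ b => φ b
  S0 := fun _ => ∅
  F := fun _ _ => ∅
  Sq := fun _ _ _ => ∅
  SX := fun _ _ _ _ => ∅
  T := fun _ _ _ _ _ _ _ => 0
  Sc := fun _ => ∅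
  Sq' := fun _ _ _ => ∅
  SX' := fun _ _ _ _ => ∅
  T' := fun _ _ _ _ _ _ => 0
  Gl := fun _ _ => 0
  E := ℂ
  ι₂ := PUnit
  s := fun _ => ∅
  Wf := fun _ _ _ _ => 0
  g := g
  e := fun _ _ => 0
  m₃ := m₃
  T₃ := fun _ _ _ => 0
  Ek1 := fun _ _ => 0
  Elog := fun _ _ => 0
  GaugeInv := fun _ => True
  Repr17 := True
  Restr := True
  c := c

/-- **The conditioned storey of the model**: per term `t = (𝐃, P)` the row bonds ARE the bonds of `P` (`Λ := ↥t.2`), no exterior bond, operator `4·1`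
at every `(σ,u)`, reference `4·1 ≻ 0`, locations `bondLoc`, σ-region `{0}`, fibre bound `1`, `uOf := 0`, Cauchy radius `1`, `Y0l := ∅`, `Pl := univ`,
and the embedding writing the real fluctuation field `B` on the term's bonds into the configuration.
[cite: Balaban1988RG2Cluster, (2.3) p.12, (2.5)–(2.7) pp.12–13, p.13, p.15 (degenerate data)] -/
def bondCond (n k m₃ : ℕ) (c : B13.Consts) (g : ℂ) (R : ℕ) : ResidB13C θ :=
  (bondBase θ n k m₃ c g).withCond 1 (bondN θ n m₃ R) ℂ (fun _ t => ↥t.2) (fun _ _ => PEmpty)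
    (fun _ _ _ _ => Matrix.diagonal fun _ => (4 : ℂ))
    (fun _ _ => Matrix.diagonal fun _ => (4 : ℝ)) (fun _ _ => diagonal_four_map.symm)
    (fun _ _ => Matrix.posDef_diagonal_iff.2 fun _ => by norm_num)
    (fun _ _ i => Sum.elim (fun b => bondLoc θ n m₃ R b.1) (fun e => PEmpty.elim e) i)
    (fun _ _ => {bondX θ n m₃ R}) (fun _ _ => 1)
    (fun Z t x => by
      refine Finset.card_le_one.2 fun a ha b hb => ?_
      simp only [Finset.mem_filter, Finset.mem_univ, true_and, Sum.elim_inl] at ha hb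
      have h := ha.trans hb.symm
      unfold bondLoc bondPt at h
      have h' := congrFun h 0
      simp only [Fin.mk.injEq] at h'
      have hval : (Fintype.equivFin (TBond 4 (m₃ + 1) ((θ.ℓ₆ + 1) * (n + 1))) a.1).val
          = (Fintype.equivFin (TBond 4 (m₃ + 1) ((θ.ℓ₆ + 1) * (n + 1))) b.1).val := by omega
      exact Subtype.ext ((Fintype.equivFin (TBond 4 (m₃ + 1) ((θ.ℓ₆ + 1) * (n + 1)))).injective (Fin.ext hval)))
    (fun _ _ _ => 0) 1 (fun _ _ => ∅) (fun _ _ => Finset.univ)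
    (fun _ t _ B b' => if h : b' ∈ t.2 then ((B ⟨b', h⟩ : ℝ) : ℂ) else 0)

/-- ★ **THE BOND-INDEXED DECORATED TOWER**: the conditioned storey decorated by fine bonds `P := Λ ⊕ C₀` located where the row bonds are, the CONSTANT
fluctuation operator `Δ₀ := 4·1`, NO decoration `J := ∅`, the identity averaging operator `C := 1` — whose decorated operator IS `4·1` at every `(σ,u)`
(`decoratedOp_diagonal_noDecor_one`), in particular the storey's reference value at `(0,0)`.
[cite: Balaban1988RG2Cluster, (2.5)–(2.8) pp.12–14, p.15; Balaban1985BackgroundPropagators, Thm 3.10 (3.107) p.416 (degenerate data)] -/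
def bondTower (n k m₃ : ℕ) (c : B13.Consts) (g : ℂ) (R : ℕ) : ResidB13D θ :=
  (bondCond θ n k m₃ c g R).withDecoration (fun Z t => (bondCond θ n k m₃ c g R).Λ Z t ⊕ (bondCond θ n k m₃ c g R).C₀ Z t)
    (fun Z t => (bondCond θ n k m₃ c g R).locN Z t)
    (fun _ _ _ => Matrix.diagonal fun _ => (4 : ℂ)) (fun _ _ _ => ∅) (fun _ _ => 1)
    (fun Z t => by
      show decoratedOp _ _ _ 0 0 = (Matrix.diagonal fun _ => (4 : ℝ)).map (algebraMap ℝ ℂ)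
      rw [diagonal_four_map]
      exact decoratedOp_diagonal_noDecor_one (E₃ := ℂ) _ 0 0)

end BondTower

/-! ## §2. Faces (`rfl`) and the trivial data of the tower -/

section Faces

variable (θ : Stage3Params) (n k m₃ : ℕ) (c : B13.Consts) (g : ℂ) (R : ℕ)

/-- [cite: Balaban1988RG2Cluster, (2.14) p.15 (bookkeeping)] -/
theorem bondTower_n : (bondTower θ n k m₃ c g R).toC.toK.layer.n = n := rfl
/-- [cite: Balaban1988RG2Cluster, (1.33) p.9 (bookkeeping)] -/
theorem bondTower_k : (bondTower θ n k m₃ c g R).toC.toK.layer.k = k := rfl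
/-- [cite: Balaban1988RG2Cluster, (2.3) p.12 (bookkeeping)] -/
theorem bondTower_m₃ : (bondTower θ n k m₃ c g R).toC.toK.layer.m₃ = m₃ := rfl
/-- [cite: Balaban1988RG2Cluster, p.20 (bookkeeping)] -/
theorem bondTower_c : (bondTower θ n k m₃ c g R).toC.toK.layer.c = c := rfl
/-- [cite: Balaban1987RG1, (2.12) p.268 (bookkeeping)] -/
theorem bondTower_g : (bondTower θ n k m₃ c g R).toC.toK.layer.g = g := rfl
/-- [cite: Balaban1988RG2Cluster, (2.14) p.15 (bookkeeping)] -/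
theorem bondTower_r : (bondTower θ n k m₃ c g R).toC.toK.r = 1 := rfl
/-- [cite: Balaban1985BackgroundPropagators, Thm 3.10 p.416 (bookkeeping: the site torus dimension)] -/
theorem bondTower_ν : (bondTower θ n k m₃ c g R).toC.toK.ν = 1 := rfl
/-- The (1.33) anchors are EMPTY. [cite: Balaban1988RG2Cluster, (1.33) p.9 (degenerate data)] -/
theorem bondTower_S0 : (bondTower θ n k m₃ c g R).toC.toK.layer.S0 = fun _ => ∅ := rfl
/-- [cite: Balaban1988RG2Cluster, (1.33) p.9 (degenerate data)] -/
theorem bondTower_Sc : (bondTower θ n k m₃ c g R).toC.toK.layer.Sc = fun _ => ∅ := rfl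
/-- [cite: Balaban1988RG2Cluster, (1.33) p.9 (degenerate data)] -/
theorem bondTower_F : (bondTower θ n k m₃ c g R).toC.toK.layer.F = fun _ _ => ∅ := rfl
/-- [cite: Balaban1988RG2Cluster, (1.33) p.9 (degenerate data)] -/
theorem bondTower_SX : (bondTower θ n k m₃ c g R).toC.toK.layer.SX = fun _ _ _ _ => ∅ := rfl
/-- [cite: Balaban1988RG2Cluster, (1.33) p.9 (degenerate data)] -/
theorem bondTower_SX' : (bondTower θ n k m₃ c g R).toC.toK.layer.SX' = fun _ _ _ _ => ∅ := rfl
/-- The (1.41) plaquette index sets are EMPTY. [cite: Balaban1988RG2Cluster, (1.41) p.11 (degenerate data)] -/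
theorem bondTower_s : (bondTower θ n k m₃ c g R).toC.toK.layer.s = fun _ => ∅ := rfl
/-- [cite: Balaban1988RG2Cluster, (1.40) p.10 (degenerate data)] -/
theorem bondTower_e : (bondTower θ n k m₃ c g R).toC.toK.layer.e = fun _ _ => 0 := rfl
/-- [cite: Balaban1988RG2Cluster, (1.41) p.11 (degenerate data)] -/
theorem bondTower_Gl : (bondTower θ n k m₃ c g R).toC.toK.layer.Gl = fun _ _ => 0 := rfl
/-- [cite: Balaban1988RG2Cluster, (1.34) p.9 (the spaces are `univ` — non-empty)] -/
theorem bondTower_sp1 : (bondTower θ n k m₃ c g R).toC.toK.layer.sp1 = fun _ => Set.univ := rfl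
/-- [cite: Balaban1988RG2Cluster, p.15 (the spaces are `univ` — non-empty)] -/
theorem bondTower_sp2 : (bondTower θ n k m₃ c g R).toC.toK.layer.sp2 = fun _ => Set.univ := rfl
/-- [cite: Balaban1988RG2Cluster, p.15 (bookkeeping)] -/
theorem bondTower_uOf : (bondTower θ n k m₃ c g R).toC.toK.uOf = fun _ _ _ => 0 := rfl
/-- The row bonds of `P` are ALL the term's bonds. [cite: Balaban1988RG2Cluster, (2.3) p.12] -/
theorem bondTower_Pl (Z : TDom 4 (n + 1)) (t : B13TermIdx θ n m₃) : (bondTower θ n k m₃ c g R).toC.toK.Pl Z t = Finset.univ := rfl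
/-- The σ-region of every term is the site `0`. [cite: Balaban1988RG2Cluster, p.13 (model)] -/
theorem bondTower_X (Z : TDom 4 (n + 1)) (t : B13TermIdx θ n m₃) :
    ((bondTower θ n k m₃ c g R).toC.toK.𝒦 Z t).X = {bondX θ n m₃ R} := rfl
/-- No decoration. [cite: Balaban1988RG2Cluster, p.3, (1.11) p.5 (model)] -/
theorem bondTower_J (Z : TDom 4 (n + 1)) (t : B13TermIdx θ n m₃) (ij) : (bondTower θ n k m₃ c g R).J Z t ij = ∅ := rfl
/-- The fluctuation operator is the constant `4·1`. [cite: Balaban1985BackgroundPropagators, Thm 3.10 (3.107) p.416 (model)] -/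
theorem bondTower_Δ₀ (Z : TDom 4 (n + 1)) (t : B13TermIdx θ n m₃) (u) :
    (bondTower θ n k m₃ c g R).Δ₀ Z t u = Matrix.diagonal fun _ => (4 : ℂ) := rfl
/-- The reference value is `4·1`. [cite: Balaban1988RG2Cluster, p.15 (model)] -/
theorem bondTower_K₀ (Z : TDom 4 (n + 1)) (t : B13TermIdx θ n m₃) :
    (bondTower θ n k m₃ c g R).K₀ Z t = Matrix.diagonal fun _ => (4 : ℝ) := rfl

/-- Every potential of the base layer vanishes (the families are empty, `Gl = 0`). [cite: Balaban1988RG2Cluster, (1.41) p.11 (degenerate data)] -/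
theorem V_eq_zero_of_empty (lam : ResidB13 θ) (hs : ∀ Y, lam.s Y = ∅) (hS0 : ∀ Y, lam.S0 Y = ∅) (hSc : ∀ Y, lam.Sc Y = ∅)
    (hGl : ∀ Y φ, lam.Gl Y φ = 0) (Y : TDom 4 ((θ.ℓ₆ + 1) * (lam.n + 1))) (φ : lam.Φ) : lam.V Y φ = 0 := by
  simp [ResidB13.V, ResidB13.Vpp, ResidB13.Vp, hs, hS0, hSc, hGl]

/-- `V_k(Y) ≡ 0` at the tower's layer of record. [cite: Balaban1988RG2Cluster, (1.41) p.11 (degenerate data)] -/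
theorem bondTower_V (Y : TDom 4 ((θ.ℓ₆ + 1) * (n + 1))) (φ) : (bondTower θ n k m₃ c g R).toC.toK.layer.V Y φ = 0 :=
  V_eq_zero_of_empty θ _ (fun _ => rfl) (fun _ => rfl) (fun _ => rfl) (fun _ _ => rfl) Y φ

/-- `V_k(Y) ≡ 0` at the tower's frame. [cite: Balaban1988RG2Cluster, (1.41) p.11 (degenerate data)] -/
theorem bondTower_frame_V (Y : TDom 4 ((θ.ℓ₆ + 1) * (n + 1))) (φ) : (bondTower θ n k m₃ c g R).toC.toK.frame.V Y φ = 0 :=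
  V_eq_zero_of_empty θ _ (fun _ => rfl) (fun _ => rfl) (fun _ => rfl) (fun _ _ => rfl) Y φ

/-- `rd ≡ 0` (no bond-to-plaquette vectors). [cite: Balaban1988RG2Cluster, (1.40) p.10 (degenerate data)] -/
theorem bondTower_rd (Y : TDom 4 ((θ.ℓ₆ + 1) * (n + 1))) (φ) : (bondTower θ n k m₃ c g R).toC.toK.layer.rd Y φ = 0 := by
  unfold ResidB13.rd
  exact Finset.sum_eq_zero fun b _ => by show φ b • (0 : ℂ) = 0; exact smul_zero _

/-- `Q ≡ 0` (no plaquette terms). [cite: Balaban1988RG2Cluster, (1.42) p.11 (degenerate data)] -/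
theorem bondTower_Q (Y : TDom 4 ((θ.ℓ₆ + 1) * (n + 1))) (φ b b') : (bondTower θ n k m₃ c g R).toC.toK.layer.Q Y φ b b' = 0 := by
  show 2 * ∑ i ∈ (∅ : Finset PUnit), _ = (0 : ℂ)
  rw [Finset.sum_empty, mul_zero]

end Faces

/-! ## §3. The geometry of the one-dimensional site torus `ℤ∕N⋆` -/

section Geometry

variable (θ : Stage3Params) (n m₃ R : ℕ)

/-- `d₁(p, 0) = min(p, N⋆ − p)` on `ℤ∕N⋆`, hence `≥ R + 1` for the bond sites `p = R + 1 + e`, `e < B` (`N⋆ − p ≥ B + R + 1`).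
[cite: Balaban1985BackgroundPropagators, Thm 3.10 p.416 (the site-torus distance; model)] -/
theorem tdist1_bondPt_bondX_ge (p : ℕ) (hp : p < 2 * (bondCount θ n m₃ + R) + 1 + 1) (hlo : R + 1 ≤ p) (hhi : p ≤ bondCount θ n m₃ + R) :
    ((R : ℝ) + 1) ≤ tdist1 (bondN θ n m₃ R) (bondPt θ n m₃ R p hp) (bondX θ n m₃ R) := by
  unfold tdist1
  rw [Fin.sum_univ_one]
  unfold B4Sect5Torus.ccoord
  have hval : (((UT.toSite (bondN θ n m₃ R) (bondPt θ n m₃ R p hp) 0).val : ℤ) - ((UT.toSite (bondN θ n m₃ R) (bondX θ n m₃ R) 0).val : ℤ)) = p := by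
    show ((p : ℕ) : ℤ) - ((0 : ℕ) : ℤ) = p
    simp
  rw [hval]
  unfold B4TorusKernel.MultiPeriod.circAbs
  have hN : ((bondN θ n m₃ R 0 : ℕ) : ℤ) = 2 * ((bondCount θ n m₃ : ℤ) + R) + 1 + 1 := by
    show (((2 * (bondCount θ n m₃ + R) + 1 + 1 : ℕ) : ℤ)) = _
    push_cast; ring
  rw [hN]
  have hmod : (p : ℤ) % (2 * ((bondCount θ n m₃ : ℤ) + R) + 1 + 1) = p :=
    Int.emod_eq_of_lt (by omega) (by omega)
  rw [hmod]
  have hmin : ((R : ℤ) + 1) ≤ min (p : ℤ) (2 * ((bondCount θ n m₃ : ℤ) + R) + 1 + 1 - p) := by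
    refine le_min (by exact_mod_cast hlo) ?_
    have : (p : ℤ) ≤ bondCount θ n m₃ + R := by exact_mod_cast hhi
    omega
  have hnn : (0 : ℤ) ≤ min (p : ℤ) (2 * ((bondCount θ n m₃ : ℤ) + R) + 1 + 1 - p) := le_trans (by positivity) hmin
  have hcast : (((min (p : ℤ) (2 * ((bondCount θ n m₃ : ℤ) + R) + 1 + 1 - p)).toNat : ℕ) : ℝ)
      = ((min (p : ℤ) (2 * ((bondCount θ n m₃ : ℤ) + R) + 1 + 1 - p) : ℤ) : ℝ) := by
    rw [← Int.cast_natCast, Int.toNat_of_nonneg hnn]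
  rw [hcast]
  exact_mod_cast hmin

/-- Every bond location is at `d₁`-distance `≥ R + 1` from the σ-site `0`. [cite: Balaban1988RG2Cluster, p.13 («σ-cubes far from the bonds»; model)] -/
theorem tdist1_bondLoc_bondX_ge (b : TBond 4 (m₃ + 1) ((θ.ℓ₆ + 1) * (n + 1))) :
    ((R : ℝ) + 1) ≤ tdist1 (bondN θ n m₃ R) (bondLoc θ n m₃ R b) (bondX θ n m₃ R) := by
  unfold bondLoc
  have := (Fintype.equivFin (TBond 4 (m₃ + 1) ((θ.ℓ₆ + 1) * (n + 1))) b).isLt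
  refine tdist1_bondPt_bondX_ge θ n m₃ R _ _ (by omega) ?_
  unfold bondCount; omega

/-- The bond locations are injective. [cite: Balaban1985BackgroundPropagators, Thm 3.10 (3.107) p.416 (model)] -/
theorem bondLoc_injective : Function.Injective (bondLoc θ n m₃ R) := by
  intro a b h
  unfold bondLoc bondPt at h
  have h' := congrFun h 0
  simp only [Fin.mk.injEq] at h'
  have hval : (Fintype.equivFin (TBond 4 (m₃ + 1) ((θ.ℓ₆ + 1) * (n + 1))) a).val
      = (Fintype.equivFin (TBond 4 (m₃ + 1) ((θ.ℓ₆ + 1) * (n + 1))) b).val := by omega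
  exact (Fintype.equivFin (TBond 4 (m₃ + 1) ((θ.ℓ₆ + 1) * (n + 1)))).injective (Fin.ext hval)

end Geometry


/-! ## §4. The object ∕ size binders of 67V ∕ 67VL at the tower -/

section Binders

/-- Entries of an identity matrix have modulus `≤ 1`; private plumbing. [folklore] -/
private theorem abs_one_apply_le_one {X : Type} [DecidableEq X] (i j : X) : |(1 : Matrix X X ℝ) i j| ≤ 1 := by
  rw [Matrix.one_apply]; split_ifs <;> simp

/-- A non-zero entry of an identity matrix is diagonal; private plumbing. [folklore] -/
private theorem eq_of_one_apply_ne_zero {X : Type} [DecidableEq X] {i j : X} (h : (1 : Matrix X X ℝ) i j ≠ 0) : i = j := by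
  by_contra hij; exact h (Matrix.one_apply_ne hij)


variable (θ : Stage3Params) (n k m₃ : ℕ) (c : B13.Consts) (g : ℂ) (R : ℕ)

/-- A term of `H(Z)` over the whole coarse torus with every bond in `P` (witness term for the `∃`-clauses of the introduction rules).
[cite: Balaban1988RG2Cluster, (2.9) p.14 (bookkeeping)] -/
theorem bondTower_witnessTerm :
    ∃ (Z : TDom 4 ((bondTower θ n k m₃ c g R).toC.n + 1)) (t : B13TermIdx θ (bondTower θ n k m₃ c g R).toC.n (bondTower θ n k m₃ c g R).toC.m₃),
      Nonempty ((bondTower θ n k m₃ c g R).toC.Λ Z t ⊕ (bondTower θ n k m₃ c g R).toC.C₀ Z t) := by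
  refine ⟨⟨Finset.univ, isTDom_univ (n + 1)⟩, (∅, Finset.univ), ⟨Sum.inl ⟨((fun _ => 0), (0 : Fin 4)), Finset.mem_univ _⟩⟩⟩

/-- ★ **`hPcard`**: the row bonds of `P` are counted by `|P|` — `(Pl Z t).card = t.2.card` for EVERY term (`Pl = univ` over `Λ = ↥t.2`).
[cite: Balaban1988RG2Cluster, (2.3) p.12 («|P| means the number of bonds in the set P»)] -/
theorem bondTower_hPcard :
    ∀ Z, ∀ t ∈ terms (θ.ℓ₆ + 1) ((bondTower θ n k m₃ c g R).toC.toK.layer.m₃ + 1) Z,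
      ((bondTower θ n k m₃ c g R).toC.toK.Pl Z t).card = t.2.card := by
  intro Z t _
  show (Finset.univ : Finset ↥t.2).card = t.2.card
  rw [Finset.card_univ, Fintype.card_coe]

/-- ★ **`hKX`**: the σ-region of every term is non-empty (the site `0`). [cite: Balaban1988RG2Cluster, p.13] -/
theorem bondTower_hKX :
    ∀ Z, ∀ t ∈ terms (θ.ℓ₆ + 1) ((bondTower θ n k m₃ c g R).toC.toK.layer.m₃ + 1) Z,
      ((bondTower θ n k m₃ c g R).toC.toK.𝒦 Z t).X.Nonempty :=
  fun _ _ _ => ⟨bondX θ n m₃ R, Finset.mem_singleton_self _⟩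

/-- ★ **`hEL`**: the constant fluctuation operator `4·1` has the TWO ENTRYWISE LETTERS on every complex ball for every rate, with `B_Δ ≥ 4`
(off-diagonal entries vanish; the diagonal is `4 ≤ B_Δ·e⁰`; constants are holomorphic). [cite: Balaban1985BackgroundPropagators, Thm 3.10 (3.107)–(3.108) p.416 (model)] -/
theorem bondTower_hEL {R₀ ρΔ BΔ : ℝ} (hB : 4 ≤ BΔ) :
    ∀ Z, ∀ t ∈ terms (θ.ℓ₆ + 1) ((bondTower θ n k m₃ c g R).toC.toK.layer.m₃ + 1) Z,
      RawEntryLetters ((bondTower θ n k m₃ c g R).Δ₀ Z t) ((bondTower θ n k m₃ c g R).locF Z t) R₀ ρΔ BΔ := by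
  intro Z t _
  refine ⟨fun u _ i j => ?_, fun i j => ?_, by linarith⟩
  · show ‖(Matrix.diagonal (fun _ => (4 : ℂ))) i j‖ ≤ _
    by_cases hij : i = j
    · subst hij
      rw [Matrix.diagonal_apply_eq, tdist1_self, mul_zero, neg_zero, Real.exp_zero, mul_one]
      have : ‖(4 : ℂ)‖ = 4 := by simp
      rw [this]; exact hB
    · rw [Matrix.diagonal_apply_ne _ hij, norm_zero]
      exact mul_nonneg (by linarith) (Real.exp_pos _).le
  · show DifferentiableOn ℂ (fun _ : ℂ => (Matrix.diagonal (fun _ => (4 : ℂ))) i j) _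
    exact differentiableOn_const _

/-- The location fibres of the term's bonds have ONE element (injective locations, no exterior bond). [cite: Balaban1985BackgroundPropagators, Thm 3.10 (3.107) p.416 (model)] -/
theorem bondTower_card_locN_fibre_le_one (Z : TDom 4 (n + 1)) (t : B13TermIdx θ n m₃) (x : UT (bondN θ n m₃ R)) :
    (Finset.univ.filter fun i : (bondTower θ n k m₃ c g R).toC.Λ Z t ⊕ (bondTower θ n k m₃ c g R).toC.C₀ Z t =>
      (bondTower θ n k m₃ c g R).toC.locN Z t i = x).card ≤ 1 := by
  refine Finset.card_le_one.2 fun a ha b hb => ?_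
  simp only [Finset.mem_filter, Finset.mem_univ, true_and] at ha hb
  rcases a with a | a
  · rcases b with b | b
    · have h : bondLoc θ n m₃ R a.1 = bondLoc θ n m₃ R b.1 := ha.trans hb.symm
      rw [Subtype.ext (bondLoc_injective θ n m₃ R h)]
    · exact PEmpty.elim b
  · exact PEmpty.elim a

/-- ★ **`hm` ∕ `hnB`**: the largest location fibre of the tower is `≤ 1` (so `locNFibreMax ≤ m` and `≤ rf.nB` for every `m, n_B ≥ 1`).
[cite: Balaban1985BackgroundPropagators, Thm 3.10 (3.107) p.416, Thm 3.12 p.423 (model)] -/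
theorem bondTower_locNFibreMax_le_one : locNFibreMax (bondTower θ n k m₃ c g R).toC ≤ 1 :=
  locNFibreMax_le_of_forall _ fun Z t x => bondTower_card_locN_fibre_le_one θ n k m₃ c g R Z t x

/-- ★ **`hmF`**: the largest fine-bond location fibre is `≤ 1` (`locF = locN`). [cite: Balaban1985BackgroundPropagators, Thm 3.10 (3.107) p.416 (model)] -/
theorem bondTower_locFFibreMax_le_one : locFFibreMax (bondTower θ n k m₃ c g R) ≤ 1 :=
  locFFibreMax_le_of_forall _ fun Z t x => bondTower_card_locN_fibre_le_one θ n k m₃ c g R Z t x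

/-- ★ **`hRσfloor`**: every bond of every term is at `d₁`-distance `≥ R + 1` from the σ-region, so the least bond-to-σ distance of the tower is
`≥ R + 1` — `rf.Rσ ≤ sigmaDistFloor` for every `R_σ ≤ R + 1`. [cite: Balaban1988RG2Cluster, p.13; Balaban1985BackgroundPropagators, Thm 3.12 p.423 (model)] -/
theorem bondTower_le_sigmaDistFloor : ((R : ℝ) + 1) ≤ sigmaDistFloor (bondTower θ n k m₃ c g R).toC := by
  refine le_sigmaDistFloor _ ?_ fun Z t i z hz => ?_
  · exact ⟨⟨Finset.univ, isTDom_univ (n + 1)⟩, (∅, Finset.univ), Sum.inl ⟨((fun _ => 0), (0 : Fin 4)), Finset.mem_univ _⟩,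
      ⟨bondX θ n m₃ R, Finset.mem_singleton_self _⟩⟩
  · have hz' : z = bondX θ n m₃ R := Finset.mem_singleton.1 hz
    subst hz'
    rcases i with b | e
    · exact tdist1_bondLoc_bondX_ge θ n m₃ R b.1
    · exact PEmpty.elim e

/-- ★ **`hm₀`**: the reference values `4·1` have the uniform real Rayleigh floor `4`, so `m₀ ≤ accretiveFloorMax` for every `m₀ ≤ 4` (the reference
packages of record have `m₀ = 2`). [cite: Balaban1988RG2Cluster, p.15; Balaban1985BackgroundPropagators, Thm 3.11 p.416 (model)] -/
theorem bondTower_le_accretiveFloorMax {m₀ : ℝ} (hm₀ : m₀ ≤ 4) : m₀ ≤ accretiveFloorMax (bondTower θ n k m₃ c g R).toC := by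
  refine le_accretiveFloorMax_decTower_of_rayleighFloor _ (fun Z t x => ?_) (bondTower_witnessTerm θ n k m₃ c g R)
  have hK : ∀ i, ((bondTower θ n k m₃ c g R).K₀ Z t *ᵥ x) i = 4 * x i := fun i => by
    show (Matrix.diagonal (fun _ => (4 : ℝ)) *ᵥ x) i = 4 * x i
    rw [Matrix.mulVec_diagonal]
  simp_rw [hK]
  have h0 : 0 ≤ ∑ i, x i ^ 2 := Finset.sum_nonneg fun i _ => sq_nonneg (x i)
  calc m₀ * ∑ i, x i ^ 2 ≤ 4 * ∑ i, x i ^ 2 := mul_le_mul_of_nonneg_right hm₀ h0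
    _ = ∑ i, x i * (4 * x i) := by rw [Finset.mul_sum]; exact Finset.sum_congr rfl fun i _ => by ring

/-- **`hsymm`** (law of `hGJ`): the (empty) decoration is symmetric. [cite: Balaban1988RG2Cluster, p.3, (1.11) p.5 (model)] -/
theorem bondTower_hsymm :
    ∀ (Z : TDom 4 ((bondTower θ n k m₃ c g R).n + 1)) (t : B13TermIdx θ (bondTower θ n k m₃ c g R).n (bondTower θ n k m₃ c g R).m₃)
      (i j : (bondTower θ n k m₃ c g R).P Z t), (bondTower θ n k m₃ c g R).J Z t (j, i) = (bondTower θ n k m₃ c g R).J Z t (i, j) :=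
  fun _ _ _ _ => rfl

/-- **`hthrough`** (law of `hGJ`): vacuous — no pair is decorated. [cite: Balaban1988RG2Cluster, p.13, (1.11) p.5 (model)] -/
theorem bondTower_hthrough :
    ∀ (Z : TDom 4 ((bondTower θ n k m₃ c g R).n + 1)) (t : B13TermIdx θ (bondTower θ n k m₃ c g R).n (bondTower θ n k m₃ c g R).m₃)
      (i j : (bondTower θ n k m₃ c g R).P Z t), ((bondTower θ n k m₃ c g R).J Z t (i, j)).Nonempty →
      ∃ z ∈ (bondTower θ n k m₃ c g R).X Z t, tdist1 (bondTower θ n k m₃ c g R).Nf ((bondTower θ n k m₃ c g R).locF Z t i) z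
        + tdist1 (bondTower θ n k m₃ c g R).Nf z ((bondTower θ n k m₃ c g R).locF Z t j)
        ≤ tdist1 (bondTower θ n k m₃ c g R).Nf ((bondTower θ n k m₃ c g R).locF Z t i) ((bondTower θ n k m₃ c g R).locF Z t j) :=
  fun _ _ _ _ h => absurd h Finset.not_nonempty_empty

/-- ★ **`hc₀`**: the decoration's cardinal excess is `0 ≤ c₀` for every slope `M₁ ≥ 0`. [cite: Balaban1988RG2Cluster, p.3, (1.11) p.5 (model)] -/
theorem bondTower_decorExcess_le {M₁ : ℝ} (hM₁ : 0 ≤ M₁) (c₀ : ℕ) : decorExcess (bondTower θ n k m₃ c g R) M₁ ≤ c₀ := by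
  refine decorExcess_le_of_card_le _ fun Z t i j => ?_
  show (((∅ : Finset (TPt 4 (n + 1))).card : ℕ) : ℝ) ≤ _
  rw [Finset.card_empty, Nat.cast_zero]
  exact add_nonneg (Nat.cast_nonneg _) (div_nonneg (tdist1_nonneg _ _) hM₁)

/-- ★ **`hCmax`**: the identity averaging operator has entries of modulus `≤ 1`. [cite: Balaban1988RG2Cluster, (2.5) p.12 (model)] -/
theorem bondTower_cmAbsMax_le_one : (cmAbsMax (bondTower θ n k m₃ c g R) : ℝ) ≤ 1 := by
  refine cmAbsMax_le_of_forall _ zero_le_one fun Z t i j => ?_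
  exact abs_one_apply_le_one i j

/-- ★ **`hrC`**: a non-zero entry of the identity averaging operator joins a fine bond to ITSELF (`d₁ = 0 ≤ r_C`). [cite: Balaban1988RG2Cluster, (2.5) p.12 (model)] -/
theorem bondTower_cmRange_le {rC : ℝ} (hrC : 0 ≤ rC) : (cmRange (bondTower θ n k m₃ c g R) : ℝ) ≤ rC := by
  refine cmRange_le_of_forall _ hrC fun Z t i j hne => ?_
  have hij : i = j := eq_of_one_apply_ne_zero hne
  subst hij
  show tdist1 _ ((bondTower θ n k m₃ c g R).toC.locN Z t i) ((bondTower θ n k m₃ c g R).toC.locN Z t i) ≤ rC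
  rw [tdist1_self]; exact hrC

/-- ★ **SIZE LAW 1**: the term's row bonds are `≤ V·|Z|` with `V = 4·((m₃+1)(ℓ₆+1))⁴` (`card Λ = |P|`, `B13TermSizeLaws.card_bonds_le_real`).
[cite: Balaban1988RG2Cluster, (2.3) p.12, p.20 (before (2.37))] -/
theorem bondTower_card_Λ_le :
    ∀ Z, ∀ t ∈ terms (θ.ℓ₆ + 1) ((bondTower θ n k m₃ c g R).toC.toK.layer.m₃ + 1) Z,
      (Fintype.card ((bondTower θ n k m₃ c g R).toC.toK.𝒦 Z t).Λ : ℝ)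
        ≤ ((4 : ℝ) * ((((m₃ + 1 : ℕ) : ℝ) * ((θ.ℓ₆ + 1 : ℕ) : ℝ)) ^ 4)) * ((Z.1).card : ℝ) := by
  intro Z t ht
  have hc : Fintype.card ((bondTower θ n k m₃ c g R).toC.toK.𝒦 Z t).Λ = t.2.card := by
    show Fintype.card ↥t.2 = t.2.card
    exact Fintype.card_coe _
  rw [hc]
  have h := card_bonds_le_real ht
  have e : ((4 : ℝ) * ((((m₃ + 1 : ℕ) : ℝ) * ((θ.ℓ₆ + 1 : ℕ) : ℝ)) ^ 4)) = ((4 : ℕ) : ℝ) * ((((m₃ + 1 : ℕ) : ℝ) * ((θ.ℓ₆ + 1 : ℕ) : ℝ)) ^ 4) := by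
    norm_num
  rw [e]
  exact h

/-- ★ **SIZE LAW 2**: `card (Λ ⊕ C₀) ≤ V·|Z|` (no exterior bond). [cite: Balaban1988RG2Cluster, (2.5)–(2.6) pp.12–13, p.20 (before (2.37))] -/
theorem bondTower_card_sum_le :
    ∀ Z, ∀ t ∈ terms (θ.ℓ₆ + 1) ((bondTower θ n k m₃ c g R).toC.toK.layer.m₃ + 1) Z,
      (Fintype.card (((bondTower θ n k m₃ c g R).toC.toK.𝒦 Z t).Λ ⊕ ((bondTower θ n k m₃ c g R).toC.toK.𝒦 Z t).C₀) : ℝ)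
        ≤ ((4 : ℝ) * ((((m₃ + 1 : ℕ) : ℝ) * ((θ.ℓ₆ + 1 : ℕ) : ℝ)) ^ 4)) * ((Z.1).card : ℝ) := by
  intro Z t ht
  have hc : Fintype.card (((bondTower θ n k m₃ c g R).toC.toK.𝒦 Z t).Λ ⊕ ((bondTower θ n k m₃ c g R).toC.toK.𝒦 Z t).C₀)
      = Fintype.card ((bondTower θ n k m₃ c g R).toC.toK.𝒦 Z t).Λ := by
    rw [Fintype.card_sum]
    show Fintype.card ↥t.2 + Fintype.card PEmpty = Fintype.card ↥t.2
    simp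
  rw [hc]
  exact bondTower_card_Λ_le θ n k m₃ c g R Z t ht

/-- ★ **SIZE LAW 3**: `#⋃𝐃 ≤ V·|Z|` (`B13TermSizeLaws.card_biUnion_doms_le_real`). [cite: Balaban1988RG2Cluster, (2.2) p.12, p.20 (before (2.37))] -/
theorem bondTower_card_biUnion_le :
    ∀ (Z : TDom 4 ((bondTower θ n k m₃ c g R).toC.toK.layer.n + 1)), ∀ t ∈ terms (θ.ℓ₆ + 1) ((bondTower θ n k m₃ c g R).toC.toK.layer.m₃ + 1) Z,
      ((((t.1).image Subtype.val).biUnion id).card : ℝ) ≤ ((4 : ℝ) * ((((m₃ + 1 : ℕ) : ℝ) * ((θ.ℓ₆ + 1 : ℕ) : ℝ)) ^ 4)) * ((Z.1).card : ℝ) := by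
  intro Z t ht
  have h := card_biUnion_doms_le_real (by norm_num : 0 < 4) ht
  have e : ((4 : ℝ) * ((((m₃ + 1 : ℕ) : ℝ) * ((θ.ℓ₆ + 1 : ℕ) : ℝ)) ^ 4)) = ((4 : ℕ) : ℝ) * ((((m₃ + 1 : ℕ) : ℝ) * ((θ.ℓ₆ + 1 : ℕ) : ℝ)) ^ 4) := by
    norm_num
  rw [e]
  exact h

/-- The block distance of the model: `dist(Y, a, j, q) := M·(side of the j-torus)`. [cite: Balaban1988RG2Cluster, (1.30) p.8 (the distance in the exponent; model)] -/
def bondDist : TDom 4 ((θ.ℓ₆ + 1) * (n + 1)) → TPt 4 ((θ.ℓ₆ + 1) * (n + 1)) → (j : ℕ) →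
    TPt 4 ((θ.ℓ₆ + 1) ^ (k - j) * ((θ.ℓ₆ + 1) * (n + 1))) → ℝ :=
  fun _ _ j _ => c.M * ((((θ.ℓ₆ + 1) ^ (k - j) * ((θ.ℓ₆ + 1) * (n + 1)) : ℕ) : ℝ))

/-- **`hdist0`** at the model's distance (`0 ≤ δ₀`, `0 ≤ M`). [cite: Balaban1988RG2Cluster, (1.30) p.8 (model)] -/
theorem bondTower_hdist0 (hδ : 0 ≤ c.δ₀) (hM : 0 ≤ c.M) : ∀ Y a j q, 0 ≤ c.δ₀ * bondDist θ n k c Y a j q :=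
  fun _ _ _ _ => mul_nonneg hδ (mul_nonneg hM (Nat.cast_nonneg _))

/-- ★ **`hdist`**: a cube of the `j`-torus OUTSIDE the `(n′+1)`-box around `L^{k−j}·a` witnesses `n′ + 1 <` the side of that torus (a box of side
`≥` the period covers the torus, `B13CubeSumTorus.image_pbox_eq_univ`), so `δ₀·M·(n′+1) ≤ δ₀·dist` for `dist := M·side`.
[cite: Balaban1988RG2Cluster, (1.30) p.8; Balaban1987RG1, p.251 (torus identification) (model)] -/
theorem bondTower_hdist (hδ : 0 ≤ c.δ₀) (hM : 0 ≤ c.M) :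
    ∀ Y a j (n' : ℕ) q, q ∉ (pbox (fun i => (((θ.ℓ₆ + 1) ^ (k - j) : ℕ) : ℤ) * natLift a i - (n' + 1 : ℕ))
      (fun i => (((θ.ℓ₆ + 1) ^ (k - j) : ℕ) : ℤ) * natLift a i + 2 * (((θ.ℓ₆ + 1) ^ (k - j) : ℕ) : ℤ) - 1 + (n' + 1 : ℕ))).image
        (proj ((θ.ℓ₆ + 1) ^ (k - j) * ((θ.ℓ₆ + 1) * (n + 1)))) →
      c.δ₀ * c.M * ((n' : ℝ) + 1) ≤ c.δ₀ * bondDist θ n k c Y a j q := by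
  intro Y a j n' q hq
  have hlt : n' + 1 ≤ (θ.ℓ₆ + 1) ^ (k - j) * ((θ.ℓ₆ + 1) * (n + 1)) := by
    by_contra hle
    have hle' : (θ.ℓ₆ + 1) ^ (k - j) * ((θ.ℓ₆ + 1) * (n + 1)) < n' + 1 := Nat.lt_of_not_le hle
    apply hq
    rw [image_pbox_eq_univ ((θ.ℓ₆ + 1) ^ (k - j) * ((θ.ℓ₆ + 1) * (n + 1)))]
    · exact Finset.mem_univ _
    · intro i
      have h1 : ((((θ.ℓ₆ + 1) ^ (k - j) * ((θ.ℓ₆ + 1) * (n + 1)) : ℕ) : ℤ)) ≤ ((n' : ℕ) : ℤ) := by exact_mod_cast (by omega)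
      push_cast at h1 ⊢
      have h2 : (0 : ℤ) ≤ ((θ.ℓ₆ : ℤ) + 1) ^ (k - j) := by positivity
      linarith
  unfold bondDist
  have hcast : ((n' : ℝ) + 1) ≤ ((((θ.ℓ₆ + 1) ^ (k - j) * ((θ.ℓ₆ + 1) * (n + 1)) : ℕ) : ℝ)) := by exact_mod_cast hlt
  have := mul_le_mul_of_nonneg_left hcast (mul_nonneg hδ hM)
  linarith [this]

/-- The embedding of the term's row bonds into the layer's bonds (the inclusion `↥t.2 ↪ bonds`). [cite: Balaban1988RG2Cluster, (2.3) p.12 (model)] -/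
def bondIota (Z : TDom 4 ((bondTower θ n k m₃ c g R).toC.toK.layer.n + 1))
    (t : Finset (TDom 4 ((θ.ℓ₆ + 1) * ((bondTower θ n k m₃ c g R).toC.toK.layer.n + 1))) ×
      Finset (TBond 4 ((bondTower θ n k m₃ c g R).toC.toK.layer.m₃ + 1) ((θ.ℓ₆ + 1) * ((bondTower θ n k m₃ c g R).toC.toK.layer.n + 1)))) :
    ((bondTower θ n k m₃ c g R).toC.toK.𝒦 Z t).Λ → (bondTower θ n k m₃ c g R).toC.toK.layer.Bond :=
  fun b => b.1

/-- The cube of a bond: the fine cube of its initial site. [cite: Balaban1988RG2Cluster, p.18 («one bond in P may connect two cubes»; model)] -/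
def bondCube : (bondTower θ n k m₃ c g R).toC.toK.layer.Bond → TPt 4 ((θ.ℓ₆ + 1) * ((bondTower θ n k m₃ c g R).toC.toK.layer.n + 1)) :=
  fun b => tcoarse (m₃ + 1) ((θ.ℓ₆ + 1) * (n + 1)) b.1

/-- **`hι`**: the embedding is injective. [cite: Balaban1988RG2Cluster, (2.3) p.12 (model)] -/
theorem bondTower_hι : ∀ Z t, Function.Injective (bondIota θ n k m₃ c g R Z t) :=
  fun _ _ _ _ h => Subtype.ext h

/-- **`hfibc`**: at most `4·(m₃+1)⁴` bonds per fine cube (`(m₃+1)⁴` sites per cube, 4 directions). [cite: Balaban1988RG2Cluster, p.18 (after (2.31)) (model)] -/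
theorem bondTower_hfibc :
    ∀ Z t (x : TPt 4 ((θ.ℓ₆ + 1) * ((bondTower θ n k m₃ c g R).toC.toK.layer.n + 1))),
      (Finset.univ.filter fun j => bondCube θ n k m₃ c g R (bondIota θ n k m₃ c g R Z t j) = x).card ≤ 4 * (m₃ + 1) ^ 4 := by
  classical
  intro Z t x
  -- into the bonds whose initial site lies in the cube `x`
  have h1 : (Finset.univ.filter fun j => bondCube θ n k m₃ c g R (bondIota θ n k m₃ c g R Z t j) = x).card
      ≤ ((Finset.univ : Finset (TBond 4 (m₃ + 1) ((θ.ℓ₆ + 1) * (n + 1)))).filter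
          fun b => tcoarse (m₃ + 1) ((θ.ℓ₆ + 1) * (n + 1)) b.1 = x).card := by
    refine Finset.card_le_card_of_injOn (fun j => j.1) (fun j hj => ?_) (fun a _ b _ h => Subtype.ext h)
    rw [Finset.mem_coe, Finset.mem_filter] at hj ⊢
    exact ⟨Finset.mem_univ _, hj.2⟩
  have h2 : ((Finset.univ : Finset (TBond 4 (m₃ + 1) ((θ.ℓ₆ + 1) * (n + 1)))).filter
        fun b => tcoarse (m₃ + 1) ((θ.ℓ₆ + 1) * (n + 1)) b.1 = x)
      ⊆ ((Finset.univ : Finset (TPt 4 ((m₃ + 1) * ((θ.ℓ₆ + 1) * (n + 1))))).filter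
          fun q => tcoarse (m₃ + 1) ((θ.ℓ₆ + 1) * (n + 1)) q = x) ×ˢ (Finset.univ : Finset (Fin 4)) := by
    intro b hb
    rw [Finset.mem_filter] at hb
    exact Finset.mem_product.2 ⟨Finset.mem_filter.2 ⟨Finset.mem_univ _, hb.2⟩, Finset.mem_univ _⟩
  refine h1.trans ((Finset.card_le_card h2).trans ?_)
  rw [Finset.card_product, Finset.card_univ, Fintype.card_fin, mul_comm]
  exact Nat.mul_le_mul_left _ (card_fiber_tcoarse_le (m₃ + 1) ((θ.ℓ₆ + 1) * (n + 1)) x)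

/-- **`hBv`**: the embedded configuration carries the real fluctuation field on the term's bonds. [cite: Balaban1988RG2Cluster, (2.14) p.15 (model)] -/
theorem bondTower_hBv :
    ∀ Z t φ B b, (bondTower θ n k m₃ c g R).toC.toK.layer.Bv ((bondTower θ n k m₃ c g R).toC.toK.emb Z t φ B) (bondIota θ n k m₃ c g R Z t b)
      = (B b : ℂ) := by
  intro Z t φ B b
  show (if h : b.1 ∈ t.2 then ((B ⟨b.1, h⟩ : ℝ) : ℂ) else 0) = (B b : ℂ)
  split_ifs with h
  · rfl
  · exact absurd b.2 h

/-- **`hBv0`**: off the term's bonds the embedded fluctuation field vanishes. [cite: Balaban1988RG2Cluster, (2.14) p.15 (model)] -/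
theorem bondTower_hBv0 :
    ∀ Z t φ B b', b' ∉ Set.range (bondIota θ n k m₃ c g R Z t) →
      (bondTower θ n k m₃ c g R).toC.toK.layer.Bv ((bondTower θ n k m₃ c g R).toC.toK.emb Z t φ B) b' = 0 := by
  intro Z t φ B b' hb'
  show (if h : b' ∈ t.2 then ((B ⟨b', h⟩ : ℝ) : ℂ) else 0) = 0
  split_ifs with h
  · exact absurd ⟨⟨b', h⟩, rfl⟩ hb'
  · rfl

/-- **`hχsupp`**: trivially (the spaces are `univ`). [cite: Balaban1988RG2Cluster, (1.34) p.9, (2.3) p.12 (model)] -/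
theorem bondTower_hχsupp :
    ∀ Z, ∀ t ∈ terms (θ.ℓ₆ + 1) ((bondTower θ n k m₃ c g R).toC.toK.layer.m₃ + 1) Z, ∀ φ ∈ (bondTower θ n k m₃ c g R).toC.toK.layer.sp2 Z, ∀ B,
      (bondTower θ n k m₃ c g R).toC.toK.chiY₀ Z t B ≠ 0 → ∀ Y ∈ t.1,
        (bondTower θ n k m₃ c g R).toC.toK.emb Z t φ B ∈ (bondTower θ n k m₃ c g R).toC.toK.layer.sp1 Y :=
  fun _ _ _ _ _ _ _ _ _ => Set.mem_univ _

/-- **`hQsupp`**: vacuous — the layer's `Q` vanishes identically. [cite: Balaban1988RG2Cluster, (1.42) p.11 (model)] -/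
theorem bondTower_hQsupp :
    ∀ (Y : TDom 4 ((θ.ℓ₆ + 1) * ((bondTower θ n k m₃ c g R).toC.toK.layer.n + 1))) φ b b',
      (bondTower θ n k m₃ c g R).toC.toK.layer.Q Y φ b b' ≠ 0 → bondCube θ n k m₃ c g R b ∈ Y.1 ∧ bondCube θ n k m₃ c g R b' ∈ Y.1 :=
  fun Y φ b b' h => absurd (bondTower_Q θ n k m₃ c g R Y φ b b') h

/-- **`huα`**: the operators read the ZERO configuration (`‖0‖ ≤ α` for `α ≥ 0`). [cite: Balaban1988RG2Cluster, p.15 (model)] -/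
theorem bondTower_huα {α : ℝ} (hα : 0 ≤ α) :
    ∀ Z, ∀ t ∈ terms (θ.ℓ₆ + 1) ((bondTower θ n k m₃ c g R).toC.toK.layer.m₃ + 1) Z, ∀ φ ∈ (bondTower θ n k m₃ c g R).toC.toK.layer.sp2 Z,
      ‖(bondTower θ n k m₃ c g R).toC.toK.uOf Z t φ‖ ≤ α :=
  fun _ _ _ _ _ => by show ‖(0 : ℂ)‖ ≤ α; rw [norm_zero]; exact hα

/-- **`hsp`**: `g·rd < ε₁` (here `rd ≡ 0`, `ε₁ > 0`). [cite: Balaban1987RG1, (2.12) p.268; Balaban1988RG2Cluster, (2.3) p.12 (model)] -/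
theorem bondTower_hsp (hε : 0 < c.ε₁) :
    ∀ Y φ, φ ∈ (bondTower θ n k m₃ c g R).toC.toK.layer.sp1 Y →
      ‖(bondTower θ n k m₃ c g R).toC.toK.layer.g‖ * ‖(bondTower θ n k m₃ c g R).toC.toK.layer.rd Y φ‖ < (bondTower θ n k m₃ c g R).toC.toK.layer.c.ε₁ := by
  intro Y φ _
  rw [bondTower_rd, norm_zero, mul_zero]
  exact hε

/-- **`hVm`**: the (2.14) potential of record is measurable in the bond variables (it is the constant `0`). [cite: Balaban1988RG2Cluster, (2.14) p.15 (model)] -/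
theorem bondTower_hVm : ∀ Z t φ Y, Measurable ((bondTower θ n k m₃ c g R).toC.toK.Vr Z t φ Y) := by
  intro Z t φ Y
  have : (bondTower θ n k m₃ c g R).toC.toK.Vr Z t φ Y = fun _ => 0 := by
    funext B
    exact bondTower_frame_V θ n k m₃ c g R Y _
  rw [this]
  exact measurable_const

/-- **`hsmallm`**: the small-field region in the bond variables is measurable (it is everything: the spaces are `univ`). [cite: Balaban1988RG2Cluster, (2.3) p.12 (model)] -/
theorem bondTower_hsmallm :
    ∀ Z t φ, MeasurableSet {B : ((bondTower θ n k m₃ c g R).toC.toK.𝒦 Z t).Λ → ℝ |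
      ∀ Y ∈ t.1, (bondTower θ n k m₃ c g R).toC.toK.emb Z t φ B ∈ (bondTower θ n k m₃ c g R).toC.toK.layer.sp1 Y} := by
  intro Z t φ
  have : {B : ((bondTower θ n k m₃ c g R).toC.toK.𝒦 Z t).Λ → ℝ |
      ∀ Y ∈ t.1, (bondTower θ n k m₃ c g R).toC.toK.emb Z t φ B ∈ (bondTower θ n k m₃ c g R).toC.toK.layer.sp1 Y} = Set.univ :=
    Set.eq_univ_of_forall fun _ _ _ => Set.mem_univ _
  rw [this]
  exact MeasurableSet.univ

/-- **`hG`**: gauge invariance is `True` at the model. [cite: Balaban1987RG1, (3.29) p.289 (model)] -/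
theorem bondTower_hG :
    ∀ Y, (bondTower θ n k m₃ c g R).toC.toK.layer.GaugeInv ((bondTower θ n k m₃ c g R).toC.toK.layer.V Y) ∧
      (bondTower θ n k m₃ c g R).toC.toK.layer.GaugeInv ((WtOfRecord θ (bondTower θ n k m₃ c g R).toC.toK.layer).toStepData.quadForm Y) ∧
      (bondTower θ n k m₃ c g R).toC.toK.layer.GaugeInv ((bondTower θ n k m₃ c g R).toC.toK.layer.Vpp Y) :=
  fun _ => ⟨trivial, trivial, trivial⟩

/-- **`he`**: `‖e(Y,b)‖ ≤ 1` (`e ≡ 0`). [cite: Balaban1988RG2Cluster, (1.40) p.10 (model)] -/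
theorem bondTower_he : ∀ Y b, ‖(bondTower θ n k m₃ c g R).toC.toK.layer.e Y b‖ ≤ 1 :=
  fun _ _ => by show ‖(0 : ℂ)‖ ≤ 1; rw [norm_zero]; exact zero_le_one

/-- **`hcard`**: no plaquette terms (`s ≡ ∅`). [cite: Balaban1988RG2Cluster, (1.41) p.11 (model)] -/
theorem bondTower_hcard (m₂ : ℕ) : ∀ Y, ((bondTower θ n k m₃ c g R).toC.toK.layer.s Y).card ≤ m₂ * Y.1.card :=
  fun _ => by show (∅ : Finset PUnit).card ≤ _; rw [Finset.card_empty]; exact Nat.zero_le _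

/-- **`hGlAn`**: the curvature terms are the constant `0` (analytic). [cite: Balaban1988RG2Cluster, (1.41)–(1.42) pp.10–11 (model)] -/
theorem bondTower_hGlAn :
    ∀ Y, AnalyticOnNhd ℂ ((bondTower θ n k m₃ c g R).toC.toK.layer.Gl Y) ((bondTower θ n k m₃ c g R).toC.toK.layer.sp1 Y) :=
  fun _ => by show AnalyticOnNhd ℂ (fun _ => (0 : ℂ)) _; exact analyticOnNhd_const

/-- **`hGl`**: `‖0‖ ≤ θ₁·(E₀ε₁C₁M^q e^{C₂κ₁})·e^{−…}` for `θ₁ ≥ 0` and positive constants. [cite: Balaban1988RG2Cluster, (1.43) p.11 (model)] -/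
theorem bondTower_hGl {θ₁ : ℝ} (hθ₁ : 0 ≤ θ₁) (hE : 0 < c.E₀) (hε : 0 < c.ε₁) (hC₁ : 0 < c.C₁) (hM : 1 ≤ c.M) :
    ∀ Y φ, φ ∈ (bondTower θ n k m₃ c g R).toC.toK.layer.sp1 Y →
      ‖(bondTower θ n k m₃ c g R).toC.toK.layer.Gl Y φ‖ ≤
        θ₁ * ((bondTower θ n k m₃ c g R).toC.toK.layer.c.E₀ * (bondTower θ n k m₃ c g R).toC.toK.layer.c.ε₁ *
          (bondTower θ n k m₃ c g R).toC.toK.layer.c.C₁ * (bondTower θ n k m₃ c g R).toC.toK.layer.c.M ^ (bondTower θ n k m₃ c g R).toC.toK.layer.c.q *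
          Real.exp ((bondTower θ n k m₃ c g R).toC.toK.layer.c.C₂ * (bondTower θ n k m₃ c g R).toC.toK.layer.c.κ₁)) *
        Real.exp (-((1 - 2 * (bondTower θ n k m₃ c g R).toC.toK.layer.c.δ) * (bondTower θ n k m₃ c g R).toC.toK.layer.c.κ *
          (tsys 4 ((θ.ℓ₆ + 1) * ((bondTower θ n k m₃ c g R).toC.toK.layer.n + 1))).dj Y)) := by
  intro Y φ _
  show ‖(0 : ℂ)‖ ≤ θ₁ * (c.E₀ * c.ε₁ * c.C₁ * c.M ^ c.q * Real.exp (c.C₂ * c.κ₁)) * Real.exp _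
  rw [norm_zero]
  have hMq : 0 < c.M ^ c.q := pow_pos (by linarith) _
  positivity

end Binders


/-! ## §5. Located note for the numerics half: the record's block size is ODD, the tree's witness families have `L = 8` -/

section Parity

variable (θ : Stage3Params)

/-- **The constants of record never have block size `8`**: `(c13OfRecord θ lam).L = θ.ℓ₆ + 1` is ODD (`Stage3Params.hL'`, [I] p. 253 «L an odd positive
integer»), so the junction's `hN : Lemma3Numerics (c13OfRecord θ layer) …` is a statement at an odd `L` (`≥ 9` under `hL8`) — NOT at the `L = 8` of the
tree's witness families `consts ∕ constsQ8 ∕ constsQ8A`; the numerics half of the joint inhabitant needs an odd-`L` family (`B13Lemma3TorusNonvacuity.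
lemma3_witness_transfer` moves the 41 Lemma-3 conjuncts to every `L ≥ 8` keeping `κ = κw`; the junction's further numeric binders have no all-`L`
producer yet). [cite: Balaban1987RG1, p.253 («L an odd positive integer»); Balaban1988RG2Cluster, p.21 (closing paragraph)] -/
theorem c13OfRecord_L_ne_eight (lam : ResidB13 θ) : (c13OfRecord θ lam).L ≠ 8 := by
  intro h
  have hodd : Odd (θ.ℓ₆ + 1) := θ.hL'.1
  rw [show (c13OfRecord θ lam).L = θ.ℓ₆ + 1 from rfl] at h
  rw [h] at hodd
  exact (Nat.not_odd_iff_even.2 (by decide : Even 8)) hodd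

/-- In particular the constants of record are never a member of this seat's witness family `constsQ8A M α₄` (whose `L` is `8`).
[cite: Balaban1988RG2Cluster, p.21 (closing paragraph), bookkeeping on the tree's witness data] -/
theorem c13OfRecord_ne_constsQ8A (lam : ResidB13 θ) (M a : ℝ) :
    c13OfRecord θ lam ≠ B13ChainJointNonvacuityPrefactors.constsQ8A M a := by
  intro h
  exact c13OfRecord_L_ne_eight θ lam (by rw [h]; rfl)

end Parity

end Literature.MathematicalPhysics.QuantumFieldTheory.Balaban1983to89.Node00

end
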